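import Summits.CriticalPhenomena.CardyFormulaZ2.Theorems.CardyComplexConeParafermionToSLESixFamiliesFlipDefs
import Summits.CriticalPhenomena.CardyFormulaZ2.Theorems.CardyComplexConeParafermionToSLESixFamiliesIicDiagArmLower
import HarnessLib

/-!
# Stub `stub_diagArmLower : DiagHalfPlaneOneArmLower` of line `flip-involution-return-law` (crux
`ParafermionToSLESixFamilies`, stmt-CriticalPhenomena-11389, route `CardyComplexCone`): its conditional status

The registered stub `stub_diagArmLower : DiagHalfPlaneOneArmLower` (`…FlipDefs`) is the non-degeneracy input
N of the line: the DIAGONAL half-plane one-arm lower bound of bond percolation on `ℤ²` at `p = 1/2`,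
`∃ c > 0, ∀ᶠ n, c · n^{-1/3} ≤ P_{1/2}[0 ↔ far sides inside the diagonal half-box {s ≤ 1, -n ≤ s, |d| ≤ n}]`
(`s = v₀ + v₁`, `d = v₀ - v₁`). Unconditionally this is OPEN (the exponent `1/3` of the half-plane one-arm
event is known on the triangular lattice only; on bond-`ℤ²` the rigorous bound is `≥ c n^{-1/2}` from the
universal half-plane arm exponents).

What this file records, sorry-free and kernel-checked in a `Theorems` module: the stub FOLLOWS from the one
named Literature fact `Literature.Probability.Percolation.IkhlefPonsaingFirstPassage` (Ikhlef–Ponsaing,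
J. Stat. Phys. 149 (2012), arXiv:1202.5476, Prop. 4.7: the closed form of the first-site passage probability
of the width-`2m+1` diagonal percolation strip), by the landed conditional theorem
`IicTraceFluxPairing.diagHalfPlaneOneArmLower_eventually_of_ikhlefPonsaing` (p119507, file
`…IicDiagArmLower.lean`: the Ikhlef–Ponsaing recursion gives `P_b(2n+1) ≥ (2n+1)^{-1/3}`, and
`P_b(2n+1) ≤ π◇(n)` by inclusion of events), whose conclusion is `DiagHalfPlaneOneArmLower` VERBATIM — the
proof below is a definitional match, no rewriting.

Status of the hypothesis (2026-08-17): `IkhlefPonsaingFirstPassage` is NOT discharged in the tree. It is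
reduced there (`Literature.Probability.Percolation.ikhlefPonsaingFirstPassage_of_polynomialSolution`, file
`Literature/Probability/Percolation/IkhlefPonsaingFirstPassageAssembly.lean`) to the existence, at a primitive
cube root of unity and for every width, of the minimal polynomial solution of Ikhlef–Ponsaing's boundary qKZ
system (`IsMinimalQKZSolution`, de Gier–Pyatov 2010 Thm. 1), itself not yet constructed. So `stub_diagArmLower`
stays open; this file is the registered helper `diagArmLower_of_ikhlefPonsaing` only.
-/

noncomputable section

open scoped Topology NNReal ENNReal BigOperators Classical
open Filter Set MeasureTheory Metric
open Literature.Probability Literature.Probability.LatticeModels Literature.Probability.Percolation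
open Literature.Probability.RandomPlanarGeometry
open Summit.CriticalPhenomena.CardyFormulaZ2.Cruxes.ParafermionToSLESixFamilies.IicTraceFluxPairing

namespace Summit.CriticalPhenomena.CardyFormulaZ2.Cruxes.ParafermionToSLESixFamilies.FlipInvolutionReturnLaw

/-- **`IkhlefPonsaingFirstPassage ⇒ DiagHalfPlaneOneArmLower`** (the registered helper of stub
`stub_diagArmLower`): given Ikhlef–Ponsaing's first-passage closed form (Prop. 4.7), the diagonal half-plane
one-arm probability of bond-`ℤ²` at `p = 1/2` is eventually `≥ 3^{-1/3} · n^{-1/3}`. This is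
`IicTraceFluxPairing.diagHalfPlaneOneArmLower_eventually_of_ikhlefPonsaing`, whose conclusion is the
definiens of `DiagHalfPlaneOneArmLower`. -/
theorem diagArmLower_of_ikhlefPonsaing :
    Literature.Probability.Percolation.IkhlefPonsaingFirstPassage → DiagHalfPlaneOneArmLower :=
  diagHalfPlaneOneArmLower_eventually_of_ikhlefPonsaing

end Summit.CriticalPhenomena.CardyFormulaZ2.Cruxes.ParafermionToSLESixFamilies.FlipInvolutionReturnLaw

end
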